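import Summits.SmoothPoincare4.SmoothPoincare4.Theorems.SoloInformedPageTori

/-!
# SoloInformedNestingClasses — the class separation behind the NESTING LEMMA (solo-informed s70)

HOME `work/s70/notes.md` §1 and `paper/doors-for-M0.md` §5 (claims C616, C653, C655).
Setting: `Y = Σ(2,3,7)`, `Γ̃ = π₁ Y = ⟨a, b ∣ a³ = b⁷ = (ab)²⟩`; the open book `S⁴ = X(b)` has tunnel
class `g₀ = a b⁻³` (C558, `SoloInformedTunnelClass`) and `g_d = b^d g₀ b^{-d}`.
NESTING LEMMA (work/s70 §1): two disjoint 'fat tunnel tori' `∂N(∂Y° ∪ α)`, `∂N(∂Y° ∪ α')` of based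
classes `g, g'` are nested, whence `g ∈ ⟨g'⟩` or `g' ∈ ⟨g⟩` in `Γ̃`.  The present file certifies the
group-theoretic input which then excludes a one-page representative of a pair of tunnel page tori
of type `d ≢ 0 (mod 7)`:

  **`g_d ∉ ⟨g₀⟩` for `d = 1, …, 6`, in `Γ̃` itself** (and hence, conjugating by `b^{-d}` and
  replacing `d` by `7 - d`, also `g₀ ∉ ⟨g_d⟩`).

The proof is a finite check in the Hurwitz quotient `Γ̃ ↠ PSL(2,8) < Perm (Fin 9)` of
`SoloInformedPageTori` (`soloInformedPermA`, `soloInformedPermB`): the image of `g₀` has order `9`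
and none of its conjugates by `b̄^d`, `d = 1, …, 6`, is a power of it.  This replaces the Fuchsian
argument of the notebook (`ḡ₀` hyperbolic in `Δ(2,3,7)`, `|tr ḡ₀| = 1 + 2cos(2π/7)`; `b̄^d` elliptic,
neither in the cyclic centraliser of `ḡ₀` nor an involution) by a kernel certificate.

* `soloInformedPermG0`, `soloInformed_permG0_order` — image of `g₀`, of order `9`.
* `soloInformed_permG0_conj_not_pow` — the finite table in `PSL(2,8)`.
* `soloInformed_tunnelClass_conj_not_zpow` — lift to any group mapping `a, b` to these generators.
* `SoloInformedBrieskorn237` — `Γ̃` as a presented group; `soloInformed_brieskorn237_relations`;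
  the Hurwitz quotient `soloInformedHurwitz237`; and the statement in `Γ̃`:
  `soloInformed_brieskorn237_tunnel_conj_not_zpow` — `b^d (a b⁻³) b^{-d} ≠ (a b⁻³)^m` for
  `1 ≤ d ≤ 6` and every `m : ℤ`; in particular (`soloInformed_brieskorn237_tunnel_conj_ne`)
  `b^d` neither centralises nor inverts `g₀`.
-/

namespace Summit.SmoothPoincare4.SmoothPoincare4.Theorems

/-- Image of the tunnel class `g₀ = a b⁻³` in `PSL(2,8) < Perm (Fin 9)` (explicit table; see
`soloInformed_permG0_eq`). -/
def soloInformedPermG0 : Equiv.Perm (Fin 9) where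
  toFun := ![8, 0, 7, 2, 3, 6, 4, 1, 5]
  invFun := ![1, 7, 3, 4, 6, 8, 5, 2, 0]
  left_inv := fun x => by fin_cases x <;> rfl
  right_inv := fun x => by fin_cases x <;> rfl

/-- The table is the image of `a b⁻³`. -/
theorem soloInformed_permG0_eq :
    soloInformedPermG0 = soloInformedPermA * soloInformedPermB⁻¹ ^ 3 := by
  decide

set_option maxRecDepth 8192 in
/-- `ḡ₀` has order `9`: `ḡ₀⁹ = 1` and `ḡ₀³ ≠ 1`. -/
theorem soloInformed_permG0_order :
    soloInformedPermG0 ^ 9 = 1 ∧ soloInformedPermG0 ^ 3 ≠ 1 := by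
  decide

set_option maxRecDepth 8192 in

/-- Finite certificate in `PSL(2,8)`: for `d = 1, …, 6` and `m = 0, …, 8`,
`b̄^d ḡ₀ b̄^{-d} ≠ ḡ₀^m`. -/
theorem soloInformed_permG0_conj_not_pow :
    ∀ d : Fin 7, d ≠ 0 → ∀ m : Fin 9,
      soloInformedPermB ^ (d : ℕ) * soloInformedPermG0 * (soloInformedPermB ^ (d : ℕ))⁻¹ ≠
        soloInformedPermG0 ^ (m : ℕ) := by
  decide

/-- Lift: in any group `G` with a homomorphism to `Perm (Fin 9)` sending `a, b` to the Hurwitz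
generators of `PSL(2,8)`, the conjugate `b^d (a b⁻³) (b^d)⁻¹`, `1 ≤ d ≤ 6`, is not an integer
power of `a b⁻³`. -/
theorem soloInformed_tunnelClass_conj_not_zpow {G : Type*} [Group G]
    (f : G →* Equiv.Perm (Fin 9)) (a b : G)
    (ha : f a = soloInformedPermA) (hb : f b = soloInformedPermB)
    (d : ℕ) (hd1 : 1 ≤ d) (hd6 : d ≤ 6) (m : ℤ) :
    b ^ d * (a * b⁻¹ ^ 3) * (b ^ d)⁻¹ ≠ (a * b⁻¹ ^ 3) ^ m := by
  intro h
  have h' := congrArg f h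
  simp only [map_mul, map_pow, map_zpow, map_inv, ha, hb] at h'
  rw [← soloInformed_permG0_eq] at h'
  rw [zpow_eq_zpow_emod' m soloInformed_permG0_order.1] at h'
  have h0 : (0 : ℤ) ≤ m % ((9 : ℕ) : ℤ) := Int.emod_nonneg _ (by norm_num)
  have h9 : m % ((9 : ℕ) : ℤ) < 9 := Int.emod_lt_of_pos _ (by norm_num)
  obtain ⟨k, hk⟩ := Int.eq_ofNat_of_zero_le h0
  rw [hk, zpow_natCast] at h'
  have hk9 : k < 9 := by omega
  have hd0 : (⟨d, by omega⟩ : Fin 7) ≠ 0 := by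
    intro e
    have := Fin.val_eq_of_eq e
    simp at this
    omega
  exact soloInformed_permG0_conj_not_pow ⟨d, by omega⟩ hd0 ⟨k, hk9⟩ h'

section presentation

/-- Relator `a³ ((ab)²)⁻¹` on the generators `0 ↦ a`, `1 ↦ b`. -/
def soloInformedRel237A : FreeGroup (Fin 2) :=
  FreeGroup.of 0 ^ 3 * ((FreeGroup.of 0 * FreeGroup.of 1) ^ 2)⁻¹

/-- Relator `b⁷ ((ab)²)⁻¹`. -/
def soloInformedRel237B : FreeGroup (Fin 2) :=
  FreeGroup.of 1 ^ 7 * ((FreeGroup.of 0 * FreeGroup.of 1) ^ 2)⁻¹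

/-- The relator set of `Γ̃ = π₁ Σ(2,3,7) = ⟨a, b ∣ a³ = (ab)² = b⁷⟩`. -/
def soloInformedRels237 : Set (FreeGroup (Fin 2)) :=
  {soloInformedRel237A, soloInformedRel237B}

/-- `Γ̃ = π₁ Σ(2,3,7)`, the binary `(2,3,7)` triangle group, as a presented group. -/
abbrev SoloInformedBrieskorn237 : Type := PresentedGroup soloInformedRels237

/-- The generator `a` (class of the order-3 exceptional fibre). -/
def soloInformedGenA : SoloInformedBrieskorn237 := PresentedGroup.of 0

/-- The generator `b` (class of the order-7 exceptional fibre). -/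
def soloInformedGenB : SoloInformedBrieskorn237 := PresentedGroup.of 1

/-- The defining relations hold in `Γ̃`: `a³ = (ab)²` and `b⁷ = (ab)²`. -/
theorem soloInformed_brieskorn237_relations :
    soloInformedGenA ^ 3 = (soloInformedGenA * soloInformedGenB) ^ 2 ∧
      soloInformedGenB ^ 7 = (soloInformedGenA * soloInformedGenB) ^ 2 := by
  have hA : PresentedGroup.mk soloInformedRels237 soloInformedRel237A = 1 :=
    PresentedGroup.one_of_mem (Set.mem_insert _ _)
  have hB : PresentedGroup.mk soloInformedRels237 soloInformedRel237B = 1 :=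
    PresentedGroup.one_of_mem (Set.mem_insert_of_mem _ (Set.mem_singleton _))
  rw [soloInformedRel237A, map_mul, map_inv, mul_inv_eq_one, map_pow, map_pow, map_mul] at hA
  rw [soloInformedRel237B, map_mul, map_inv, mul_inv_eq_one, map_pow, map_pow, map_mul] at hB
  exact ⟨hA, hB⟩

/-- Images of the generators in `PSL(2,8) < Perm (Fin 9)`. -/
def soloInformedHurwitzGens : Fin 2 → Equiv.Perm (Fin 9) :=
  ![soloInformedPermA, soloInformedPermB]

/-- The Hurwitz generators satisfy the relators of `Γ̃`. -/
theorem soloInformed_hurwitzGens_rels :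
    ∀ r ∈ soloInformedRels237, FreeGroup.lift soloInformedHurwitzGens r = 1 := by
  intro r hr
  rcases hr with rfl | hr
  · simp only [soloInformedRel237A, map_mul, map_pow, map_inv, FreeGroup.lift_apply_of,
      soloInformedHurwitzGens, Matrix.cons_val_zero, Matrix.cons_val_one]
    decide
  · rw [Set.mem_singleton_iff] at hr
    subst hr
    simp only [soloInformedRel237B, map_mul, map_pow, map_inv, FreeGroup.lift_apply_of,
      soloInformedHurwitzGens, Matrix.cons_val_zero, Matrix.cons_val_one]
    decide

/-- The Hurwitz quotient `Γ̃ ↠ PSL(2,8) < Perm (Fin 9)`. -/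
def soloInformedHurwitz237 : SoloInformedBrieskorn237 →* Equiv.Perm (Fin 9) :=
  PresentedGroup.toGroup soloInformed_hurwitzGens_rels

/-- The Hurwitz quotient sends `a` to `soloInformedPermA`. -/
theorem soloInformed_hurwitz237_genA : soloInformedHurwitz237 soloInformedGenA = soloInformedPermA :=
  (PresentedGroup.toGroup.of soloInformed_hurwitzGens_rels).trans rfl

/-- The Hurwitz quotient sends `b` to `soloInformedPermB`. -/
theorem soloInformed_hurwitz237_genB : soloInformedHurwitz237 soloInformedGenB = soloInformedPermB :=
  (PresentedGroup.toGroup.of soloInformed_hurwitzGens_rels).trans rfl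

/-- **Class separation in `Γ̃`** (input of the nesting lemma, C616/C653): for `1 ≤ d ≤ 6` and every
`m : ℤ`, `b^d (a b⁻³) b^{-d} ≠ (a b⁻³)^m` in `Γ̃ = π₁ Σ(2,3,7)`; i.e. `g_d ∉ ⟨g₀⟩`. -/
theorem soloInformed_brieskorn237_tunnel_conj_not_zpow (d : ℕ) (hd1 : 1 ≤ d) (hd6 : d ≤ 6)
    (m : ℤ) :
    soloInformedGenB ^ d * (soloInformedGenA * soloInformedGenB⁻¹ ^ 3) * (soloInformedGenB ^ d)⁻¹ ≠
      (soloInformedGenA * soloInformedGenB⁻¹ ^ 3) ^ m :=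
  soloInformed_tunnelClass_conj_not_zpow soloInformedHurwitz237 _ _ soloInformed_hurwitz237_genA
    soloInformed_hurwitz237_genB d hd1 hd6 m

/-- In particular `b^d` (`1 ≤ d ≤ 6`) neither centralises nor inverts the tunnel class `g₀ = a b⁻³`
in `Γ̃` — so `g_d ≠ g₀` and `g_d ≠ g₀⁻¹`. -/
theorem soloInformed_brieskorn237_tunnel_conj_ne (d : ℕ) (hd1 : 1 ≤ d) (hd6 : d ≤ 6) :
    soloInformedGenB ^ d * (soloInformedGenA * soloInformedGenB⁻¹ ^ 3) * (soloInformedGenB ^ d)⁻¹ ≠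
        soloInformedGenA * soloInformedGenB⁻¹ ^ 3 ∧
      soloInformedGenB ^ d * (soloInformedGenA * soloInformedGenB⁻¹ ^ 3) * (soloInformedGenB ^ d)⁻¹ ≠
        (soloInformedGenA * soloInformedGenB⁻¹ ^ 3)⁻¹ := by
  refine ⟨fun h => ?_, fun h => ?_⟩
  · exact soloInformed_brieskorn237_tunnel_conj_not_zpow d hd1 hd6 1 (by rwa [zpow_one])
  · exact soloInformed_brieskorn237_tunnel_conj_not_zpow d hd1 hd6 (-1) (by rwa [zpow_neg_one])

end presentation

end Summit.SmoothPoincare4.SmoothPoincare4.Theorems
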